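import Summits.ValiantsHypothesis.ValiantsHypothesis.Theorems.FeketeSOSFeketeSOSHardPaleyRIPMassIdentity
import Summits.ValiantsHypothesis.ValiantsHypothesis.Theorems.FeketeSOSFeketeSOSHardPaleyRIPCompletion
import Mathlib.Analysis.SpecialFunctions.Pow.Real

/-!
# Route FeketeSOS — crux `FeketeSOSHard` (stmt-ValiantsHypothesis-3996), line `paley-rip`:
# the UNCONDITIONAL residue — the archimedean mass floor `Σ_i |c_i|·‖g_i‖₂² ≥ (p − 1)/√p`

The line of record `Cruxes/FeketeSOSHard/Lines/paley_rip.lean` composes its two PROVABLE stubs into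
`massFloor_of`; both stubs are now theorems of the tree
(`stub_paleyMassIdentity`, `…PaleyRIPMassIdentity.lean`; `stub_paleyCompletionBound`,
`…PaleyRIPCompletion.lean`), so the composition is landed here WITHOUT hypotheses beyond the
representation itself:

> every cyclic sum-of-squares representation `X^p − 1 ∣ Σ_i c_i g_i² − F_p` of the Fekete polynomial over
> `ℂ` with `deg g_i < p` (any number of squares, any supports) has archimedean mass
> `Σ_i |c_i| · Σ_a |g_i(a)|² ≥ (p − 1)/√p`, i.e. `(p − 1) ≤ √p · Σ_i sqMass c_i g_i`.

Proof (the line's, verbatim up to the stub names): `p − 1 = |Σ_i c_i Q_p(g_i)| ≤ Σ_i |c_i|·|Q_p(g_i)|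
≤ Σ_i |c_i| · √p ‖g_i‖₂²`. Sharp up to the constant: the dense Gram solution `τ = P/p` has mass `≈ √p`.

Honest framing: this is the line's guaranteed residue, not the crux: `FeketeSOSHard` (sparse SOS
hardness of `F_p`), the engine `stub_paleyFlatRIP` and `stub_tameReduction` remain OPEN; nothing here
bears on `VP ≠ VNP`.
-/

set_option linter.dupNamespace false

namespace Summit.ValiantsHypothesis.ValiantsHypothesis.Theorems.FeketeSOSHardPaleyRIP

open Polynomial Finset
open scoped BigOperators

noncomputable section

/-- **The archimedean mass floor for cyclic SOS representations of the Fekete polynomial**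
(line `paley-rip`, composition `massFloor_of` of the now-proved stubs 1 and 4): if
`X^p − 1 ∣ Σ_i c_i g_i² − F_p` over `ℂ` with `deg g_i < p`, then `p − 1 ≤ √p · Σ_i |c_i| Σ_a |g_i(a)|²`. -/
theorem massFloor (p : ℕ) [Fact p.Prime] (s : ℕ) (c : Fin s → ℂ) (g : Fin s → ℂ[X])
    (hdeg : ∀ i, (g i).natDegree < p)
    (hdvd : (X : ℂ[X]) ^ p - 1 ∣ (∑ i, C (c i) * g i ^ 2) - fek p) :
    (p : ℝ) - 1 ≤ Real.sqrt p * ∑ i, sqMass (c i) (g i) := by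
  classical
  have hprime : p.Prime := Fact.out
  have hid := stub_paleyMassIdentity p s c g hdeg hdvd
  have hnorm : ‖(p : ℂ) - 1‖ = (p : ℝ) - 1 := by
    have e : ((p : ℂ) - 1) = (((p : ℝ) - 1 : ℝ) : ℂ) := by push_cast; ring
    have h1 : (1 : ℝ) ≤ (p : ℝ) := by exact_mod_cast hprime.one_lt.le
    rw [e, Complex.norm_real, Real.norm_eq_abs, abs_of_nonneg (by linarith)]
  have hQ : ∀ i, ‖paleyForm p (g i).support (fun a => (g i).coeff a)‖ ≤
      Real.sqrt p * ∑ a ∈ (g i).support, ‖(g i).coeff a‖ ^ 2 := fun i =>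
    stub_paleyCompletionBound p (g i).support
      (fun a ha => lt_of_le_of_lt (le_natDegree_of_mem_supp a ha) (hdeg i)) (fun a => (g i).coeff a)
  rw [← hnorm, ← hid]
  calc ‖∑ i, c i * paleyForm p (g i).support (fun a => (g i).coeff a)‖
      ≤ ∑ i, ‖c i * paleyForm p (g i).support (fun a => (g i).coeff a)‖ := norm_sum_le _ _
    _ = ∑ i, ‖c i‖ * ‖paleyForm p (g i).support (fun a => (g i).coeff a)‖ := by simp_rw [norm_mul]
    _ ≤ ∑ i, ‖c i‖ * (Real.sqrt p * ∑ a ∈ (g i).support, ‖(g i).coeff a‖ ^ 2) :=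
        sum_le_sum fun i _ => mul_le_mul_of_nonneg_left (hQ i) (norm_nonneg _)
    _ = Real.sqrt p * ∑ i, sqMass (c i) (g i) := by
        rw [mul_sum]; refine sum_congr rfl fun i _ => ?_; unfold sqMass; ring

/-- The same floor in the divided form `(p − 1)/√p ≤ Σ_i sqMass c_i g_i`. -/
theorem massFloor_div (p : ℕ) [Fact p.Prime] (s : ℕ) (c : Fin s → ℂ) (g : Fin s → ℂ[X])
    (hdeg : ∀ i, (g i).natDegree < p)
    (hdvd : (X : ℂ[X]) ^ p - 1 ∣ (∑ i, C (c i) * g i ^ 2) - fek p) :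
    ((p : ℝ) - 1) / Real.sqrt p ≤ ∑ i, sqMass (c i) (g i) := by
  have hp : (0 : ℝ) < Real.sqrt p :=
    Real.sqrt_pos.2 (by exact_mod_cast (Fact.out : p.Prime).pos)
  rw [div_le_iff₀ hp, mul_comm]
  exact massFloor p s c g hdeg hdvd

end

end Summit.ValiantsHypothesis.ValiantsHypothesis.Theorems.FeketeSOSHardPaleyRIP
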